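import Literature.MathematicalPhysics.QuantumLattice.GrassmannEffectiveActionTruncationDB
import Literature.MathematicalPhysics.QuantumLattice.GrassmannKernelYoung
import Literature.MathematicalPhysics.QuantumLattice.GrassmannEffectiveActionRepresentation
import HarnessLib

/-!
# The DEGREE-GRADED single-scale step for determinant-bounded covariances

Topic `MathematicalPhysics/QuantumLattice`; continuation of `GrassmannEffectiveActionTruncationDB`.  The single-scale step
`Σ_{W : W_i = w} ‖kernel_r (effAction C V) (W)‖ ≤ ρ^{-r} e‖V‖_h/(1 - θ)` (`θ = eα‖V‖_h/κ²`) is of FIRST order in `‖V‖_h` in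
every output degree `r`.  For an interaction of bounded degree this loses the perturbative order of the high-degree kernels:
the `n`-th truncated expectation `𝓔ᵀ_C(V; n)` of an interaction with kernels of degree `≤ 2d` has kernels of degree
`≤ 2dn - 2(n-1) = 2(d-1)n + 2` only (each of the `n - 1` lines of a connecting tree consumes two fields; Benfatto–Giuliani–
Mastropietro 2006, (2.13)–(2.14): the degree-`2p` kernel of the effective action of a QUARTIC interaction starts at order
`p - 1`), so in degree `r > 2(d-1)(n₀-1) + 2` the cumulants of order `< n₀` do not contribute and the geometric tail of
`GrassmannEffectiveActionTruncationDB.sum_norm_kernel_effAction_add_sum_cumulant_le_of_gramBounded` gives the extra factor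
`θ^{n₀-1}`:

* `kernel_cumulantOf_eq_zero_of_degree_lt` — the degree-`r` kernels of `𝓔ᵀ_C(-V; n)` vanish for `2(d-1)n + 2 < r`
  (read off the degree indicator of `GrassmannCumulantBoundDB.sum_norm_kernel_cumulantOf_le_of_gramBounded`);
* **`sum_norm_kernel_effAction_le_pow_of_gramBounded_of_degree`** — the graded step:
  `Σ_{W : W_i = w} ‖kernel_r (effAction C V) (W)‖ ≤ ρ^{-r} e‖V‖_h θ^{n₀-1}/(1 - θ)` whenever `2(d-1)(n₀-1) + 2 < r`;
* `sum_norm_kernel_effAction_le_pow_of_gramBounded_quartic`, `kernelNorm_kernel_effAction_le_pow_of_gramBounded_quartic` —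
  the quartic case `d = 2` in degree `2p`, `p ≥ 2`: the factor is `θ^{p-2}`, i.e. the degree-`2p` kernel is of order
  `‖V‖_h^{p-1}` (pinned form and `kernelNorm 1` form);
* `kernelNorm_kernel_map_effAction_le_pow_of_gramBounded_quartic` — the same read through a substitution `f` and an analysis
  map `g` (the graded, determinant-bounded twin of `GrassmannEffectiveActionRepresentation.kernelNorm_kernel_map_effAction_le`:
  sectorising / re-gridding the output legs costs the row and column sums `cr · cc^{2p-1}` of `‖E M‖`, once per leg).

With the output field weight `ρ = κ` the Gram constant CANCELS order by order in the quartic case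
(`ρ^{-2p} · κ⁴ · (κ⁴/κ²)^{p-2} · 16^{p-1} = 16^{p-1}`): this is the form in which the ultraviolet (scale-zero) integration of
lattice fermions under the Pedra–Salmhofer determinant bound — whose Gram constant is large — still produces kernel norms
`≤ C^p ‖V‖^{p-1}` in degree `2p` (cell gate-hubbard-kl, K3 engine child, clause (E1) at scale `0`).

Everything is proved; no definition, no named fact.

## Sources

G. Benfatto, A. Giuliani, V. Mastropietro, Ann. Henri Poincaré 7 (2006) 809–898, (2.13)–(2.14), (2.77)–(2.80)
[`BenfattoGiulianiMastropietro2006`]; W. de Siqueira Pedra, M. Salmhofer, Comm. Math. Phys. 282 (2008) 797–818, Thm 2.4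
[`PedraSalmhofer2008`]; K. Gawȩdzki, A. Kupiainen, Comm. Math. Phys. 102 (1985) 1–30, §3 [`GawedzkiKupiainen1985GrossNeveu`].
-/

noncomputable section

namespace Literature.MathematicalPhysics.QuantumLattice

open GrassmannAlgebra Finset Literature.Probability.LatticeModels
open scoped InnerProductSpace Nat

universe u

variable {𝕜 : Type*} [RCLike 𝕜] {Γ : Type u} [Fintype Γ] [DecidableEq Γ] (C : Matrix Γ Γ 𝕜)

/-- **The high-degree kernels of the low-order truncated expectations vanish** (Benfatto–Giuliani–Mastropietro 2006,
(2.13)–(2.14): a connected cluster of `n` vertices of degrees `≤ 2d` joined by `n - 1` lines has at most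
`2dn - 2(n-1)` external legs): if the kernels of `V` vanish in every degree `2m' > 2d`, then for `1 ≤ n` and
`2(d-1)n + 2 < r` every degree-`r` kernel of `𝓔ᵀ_C(-V; n)` is `0` — read off the degree indicator
`[r + 2(n-1) ≤ Σ_a 2δ_a]` of `sum_norm_kernel_cumulantOf_le_of_gramBounded`, the degree assignments with some `δ_a > d`
carrying the vanishing pinned norm `N(δ_a) = 0`. [cite: BenfattoGiulianiMastropietro2006, (2.13)-(2.14)] -/
theorem kernel_cumulantOf_eq_zero_of_degree_lt {κ : ℝ} (hκ : 0 ≤ κ) (hGB : IsGramBoundedR C κ)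
    (V : GrassmannAlgebra 𝕜 Γ) (hV : V ∈ evenPart 𝕜 Γ) {d : ℕ}
    (hdeg : ∀ m', d < m' → ∀ Y : Fin (2 * m') → Γ, kernel 𝕜 V (2 * m') Y = 0)
    {n : ℕ} (hn : 0 < n) {r : ℕ} (hr : 2 * (d - 1) * n + 2 < r) (W : Fin r → Γ) :
    kernel 𝕜 ((cumulantOf (fun k => evenGaussConv 𝕜 C ((⟨-V, neg_mem hV⟩ : evenPart 𝕜 Γ) ^ k)) n :
      evenPart 𝕜 Γ) : GrassmannAlgebra 𝕜 Γ) r W = 0 := by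
  classical
  -- `-V` as the `vertexOf` of its kernels
  set X : evenPart 𝕜 Γ := ⟨-V, neg_mem hV⟩ with hX
  obtain ⟨degs, hdegs⟩ : ∃ degs : Finset ℕ, degs = range (Fintype.card Γ / 2 + 1) := ⟨_, rfl⟩
  obtain ⟨K, hK⟩ : ∃ K : (m' : ℕ) → (Fin (2 * m') → Γ) → 𝕜, K = fun m' => kernel 𝕜 (-V) (2 * m') := ⟨_, rfl⟩
  have hXv : vertexOf 𝕜 degs K = X := by
    rw [hK, hdegs]
    exact Subtype.ext (coe_vertexOf_kernel_eq 𝕜 X)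
  have hKnorm : ∀ (m' : ℕ) (Y : Fin (2 * m') → Γ), ‖K m' Y‖ = ‖kernel 𝕜 V (2 * m') Y‖ := by
    intro m' Y
    rw [hK]
    dsimp only
    rw [show -V = (-1 : 𝕜) • V from (neg_one_smul 𝕜 V).symm, kernel_smul, norm_mul, norm_neg, norm_one, one_mul]
  -- pinned norms: the true ones in degrees `≤ 2d`, zero above
  obtain ⟨N, hN⟩ : ∃ N : ℕ → ℝ, N = fun m' => if m' ≤ d then
      ∑ j : Fin (2 * m'), ∑ w : Γ, ∑ Y ∈ univ.filter (fun Y : Fin (2 * m') → Γ => Y j = w), ‖kernel 𝕜 V (2 * m') Y‖ else 0 :=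
    ⟨_, rfl⟩
  have hN0 : ∀ m', 0 ≤ N m' := fun m' => by
    rw [hN]
    dsimp only
    split_ifs
    · positivity
    · exact le_rfl
  have hN' : ∀ (m' : ℕ) (j : Fin (2 * m')) (w : Γ),
      ∑ Y ∈ univ.filter (fun Y : Fin (2 * m') → Γ => Y j = w), ‖K m' Y‖ ≤ N m' := by
    intro m' j w
    simp only [hKnorm]
    rw [hN]
    dsimp only
    split_ifs with hm'
    · calc ∑ Y ∈ univ.filter (fun Y : Fin (2 * m') → Γ => Y j = w), ‖kernel 𝕜 V (2 * m') Y‖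
          ≤ ∑ w' : Γ, ∑ Y ∈ univ.filter (fun Y : Fin (2 * m') → Γ => Y j = w'), ‖kernel 𝕜 V (2 * m') Y‖ :=
            single_le_sum (f := fun w' => ∑ Y ∈ univ.filter (fun Y : Fin (2 * m') → Γ => Y j = w'), ‖kernel 𝕜 V (2 * m') Y‖)
              (fun w' _ => sum_nonneg fun _ _ => norm_nonneg _) (mem_univ w)
        _ ≤ ∑ j' : Fin (2 * m'), ∑ w' : Γ, ∑ Y ∈ univ.filter (fun Y : Fin (2 * m') → Γ => Y j' = w'), ‖kernel 𝕜 V (2 * m') Y‖ :=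
            single_le_sum (f := fun j' => ∑ w' : Γ, ∑ Y ∈ univ.filter (fun Y : Fin (2 * m') → Γ => Y j' = w'),
              ‖kernel 𝕜 V (2 * m') Y‖) (fun j' _ => by positivity) (mem_univ j)
    · exact le_of_eq (sum_eq_zero fun Y _ => by rw [hdeg m' (not_le.1 hm') Y, norm_zero])
  -- the pinned bound for the cumulant: every degree assignment contributes `0`
  have hr0 : 0 < r := lt_of_le_of_lt (Nat.zero_le _) hr
  have hα0 : (0 : ℝ) ≤ ∑ X, ∑ Y, ‖C X Y‖ := by positivity
  have hrowC : ∀ X, ∑ Y, ‖C X Y‖ ≤ ∑ X, ∑ Y, ‖C X Y‖ := fun X =>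
    single_le_sum (f := fun X' => ∑ Y, ‖C X' Y‖) (fun _ _ => by positivity) (mem_univ X)
  have hcolC : ∀ Y, ∑ X, ‖C X Y‖ ≤ ∑ X, ∑ Y, ‖C X Y‖ := fun Y => by
    rw [sum_comm]
    exact single_le_sum (f := fun Y' => ∑ X, ‖C X Y'‖) (fun _ _ => by positivity) (mem_univ Y)
  have h := sum_norm_kernel_cumulantOf_le_of_gramBounded C hκ hGB degs K N hN0 hN' hα0 hrowC hcolC
    (fun _ => 1) (fun _ => one_pos) hn (⟨0, hr0⟩ : Fin r) (W ⟨0, hr0⟩)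
  have hzero : ∀ δ ∈ Fintype.piFinset (fun _ : Fin n => degs),
      (if r + 2 * (n - 1) ≤ ∑ a, 2 * δ a then cumulantBound n κ (∑ X, ∑ Y, ‖C X Y‖) ((fun _ => (1 : ℝ)) δ) N r δ else 0) = 0 := by
    intro δ _
    split_ifs with hle
    · -- some vertex has degree above `2d` (else `r + 2(n-1) ≤ 2dn`, contradicting `2(d-1)n + 2 < r`), so `∏ N(δ_a) = 0`
      have hex : ∃ a, d < δ a := by
        by_contra hcon
        simp only [not_exists, not_lt] at hcon
        obtain ⟨S, hS⟩ : ∃ S, ∑ a, 2 * δ a = S := ⟨_, rfl⟩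
        rw [hS] at hle
        rcases Nat.eq_zero_or_pos d with hd | hd
        · have hS0 : S = 0 := by
            rw [← hS]
            exact sum_eq_zero fun a _ => by have := hcon a; omega
          omega
        · obtain ⟨d', rfl⟩ : ∃ d', d = d' + 1 := ⟨d - 1, by omega⟩
          obtain ⟨P, hP⟩ : ∃ P, d' * n = P := ⟨_, rfl⟩
          have hr' : 2 * P + 2 < r := by
            rw [Nat.add_sub_cancel, mul_assoc, hP] at hr
            exact hr
          have hSle : S ≤ 2 * P + 2 * n := by
            rw [← hS]
            calc ∑ a, 2 * δ a ≤ ∑ _a : Fin n, 2 * (d' + 1) := sum_le_sum fun a _ => Nat.mul_le_mul_left 2 (hcon a)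
              _ = 2 * P + 2 * n := by
                  rw [sum_const, card_univ, Fintype.card_fin, smul_eq_mul, ← hP]
                  ring
          omega
      obtain ⟨a, ha⟩ := hex
      have hNa : N (δ a) = 0 := by
        rw [hN]
        dsimp only
        rw [if_neg (not_le.2 ha)]
      rw [cumulantBound, prod_eq_zero (mem_univ a) hNa]
      ring
    · rfl
  -- a sum of norms `≤ 0` forces every term to vanish
  have hsum0 : ∑ W' ∈ univ.filter (fun W' : Fin r → Γ => W' ⟨0, hr0⟩ = W ⟨0, hr0⟩),
      ‖kernel 𝕜 ((cumulantOf (fun k => evenGaussConv 𝕜 C (vertexOf 𝕜 degs K ^ k)) n : evenPart 𝕜 Γ) :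
        GrassmannAlgebra 𝕜 Γ) r W'‖ ≤ 0 := by
    refine h.trans (le_of_eq ?_)
    rw [sum_congr rfl hzero, sum_const_zero, mul_zero]
  have hle : ‖kernel 𝕜 ((cumulantOf (fun k => evenGaussConv 𝕜 C (vertexOf 𝕜 degs K ^ k)) n : evenPart 𝕜 Γ) :
      GrassmannAlgebra 𝕜 Γ) r W‖ ≤ 0 :=
    (single_le_sum (s := univ.filter (fun W' : Fin r → Γ => W' ⟨0, hr0⟩ = W ⟨0, hr0⟩)) (f := fun W' : Fin r → Γ =>
      ‖kernel 𝕜 ((cumulantOf (fun k => evenGaussConv 𝕜 C (vertexOf 𝕜 degs K ^ k)) n : evenPart 𝕜 Γ) :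
        GrassmannAlgebra 𝕜 Γ) r W'‖) (fun _ _ => norm_nonneg _) (mem_filter.2 ⟨mem_univ W, rfl⟩)).trans hsum0
  rw [← hXv]
  exact norm_le_zero_iff.1 hle

/-- **The degree-graded single-scale step** (Benfatto–Giuliani–Mastropietro 2006, (2.13)–(2.14) with (2.77)–(2.80);
Gawȩdzki–Kupiainen 1985, §3): under the hypotheses of `sum_norm_kernel_effAction_le_of_gramBounded` (charged covariance,
replica-Gram-bounded with constant `κ`, row and column sums `≤ α`, output weight `ρ`, `θ = eα‖V‖_h/κ² < 1`), if moreover the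
kernels of `V` vanish in every degree `2m' > 2d`, then for `n₀ ≥ 1` and every output degree `r > 2(d-1)(n₀-1) + 2`, one label
pinned, `Σ_{W : W_i = w} ‖kernel_r (effAction C V) (W)‖ ≤ ρ^{-r} · e‖V‖_h · θ^{n₀-1}/(1 - θ)` — the cumulants of order `< n₀`
have no degree-`r` kernels. [cite: BenfattoGiulianiMastropietro2006, (2.13)-(2.14) and (2.77)-(2.80)] -/
theorem sum_norm_kernel_effAction_le_pow_of_gramBounded_of_degree {κ : ℝ} (hκ : 0 < κ) (hGB : IsGramBoundedR C κ)
    (V : GrassmannAlgebra 𝕜 Γ) (hV : V ∈ evenPart 𝕜 Γ) (hV0 : constPart 𝕜 V = 0) (N : ℕ → ℝ) (hN0 : ∀ m', 0 ≤ N m')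
    (hN : ∀ m' (j : Fin (2 * m')) (w : Γ), ∑ Y ∈ univ.filter (fun Y : Fin (2 * m') → Γ => Y j = w), ‖kernel 𝕜 V (2 * m') Y‖ ≤ N m')
    {d : ℕ} (hdeg : ∀ m', d < m' → ∀ Y : Fin (2 * m') → Γ, kernel 𝕜 V (2 * m') Y = 0)
    {α : ℝ} (hα : 0 < α) (hrow : ∀ X, ∑ Y, ‖C X Y‖ ≤ α) (hcol : ∀ Y, ∑ X, ‖C X Y‖ ≤ α) {ρ : ℝ} (hρ : 0 < ρ)
    (hθ : Real.exp 1 * α * normV Γ κ ρ N / κ ^ 2 < 1) {n₀ : ℕ} (hn₀ : 0 < n₀) {r : ℕ}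
    (hr : 2 * (d - 1) * (n₀ - 1) + 2 < r) (i : Fin r) (w : Γ) :
    IsUnit (effPartitionFn 𝕜 C V) ∧
      ∑ W ∈ univ.filter (fun W : Fin r → Γ => W i = w), ‖kernel 𝕜 (effAction 𝕜 C V) r W‖ ≤
        ρ⁻¹ ^ r * (Real.exp 1 * normV Γ κ ρ N) *
          (Real.exp 1 * α * normV Γ κ ρ N / κ ^ 2) ^ (n₀ - 1) / (1 - Real.exp 1 * α * normV Γ κ ρ N / κ ^ 2) := by
  have hr0 : 0 < r := by omega
  obtain ⟨hunit, hbd⟩ := sum_norm_kernel_effAction_add_sum_cumulant_le_of_gramBounded C hκ hGB V hV hV0 N hN0 hN hα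
    hrow hcol hρ hθ hn₀
  refine ⟨hunit, ?_⟩
  have h := hbd hr0 i w
  refine (le_of_eq (sum_congr rfl fun W _ => ?_)).trans h
  -- the cumulants of order `< n₀` have no degree-`r` kernels
  rw [sum_eq_zero fun n hn => ?_, add_zero]
  have hn1 : 1 ≤ n := (mem_Ico.1 hn).1
  have hn2 : n < n₀ := (mem_Ico.1 hn).2
  have hrn : 2 * (d - 1) * n + 2 < r :=
    lt_of_le_of_lt (Nat.add_le_add_right (Nat.mul_le_mul_left _ (by omega)) 2) hr
  rw [kernel_cumulantOf_eq_zero_of_degree_lt C hκ.le hGB V hV hdeg hn1 hrn W, mul_zero]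

/-- **The graded step for a QUARTIC interaction** (`d = 2`: kernels of degrees `2` and `4` only): in output degree `2p`,
`p ≥ 2`, one label pinned, `Σ_{W : W_i = w} ‖kernel_{2p} (effAction C V) (W)‖ ≤ ρ^{-2p} · e‖V‖_h · θ^{p-2}/(1 - θ)` — the
degree-`2p` kernel of the effective action is of order `p - 1` in the interaction (BGM 2006, (2.13)–(2.14): `2p` external legs
need `p - 1` quartic vertices). [cite: BenfattoGiulianiMastropietro2006, (2.13)-(2.14) and (2.77)-(2.80)] -/
theorem sum_norm_kernel_effAction_le_pow_of_gramBounded_quartic {κ : ℝ} (hκ : 0 < κ) (hGB : IsGramBoundedR C κ)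
    (V : GrassmannAlgebra 𝕜 Γ) (hV : V ∈ evenPart 𝕜 Γ) (hV0 : constPart 𝕜 V = 0) (N : ℕ → ℝ) (hN0 : ∀ m', 0 ≤ N m')
    (hN : ∀ m' (j : Fin (2 * m')) (w : Γ), ∑ Y ∈ univ.filter (fun Y : Fin (2 * m') → Γ => Y j = w), ‖kernel 𝕜 V (2 * m') Y‖ ≤ N m')
    (hdeg : ∀ m', 2 < m' → ∀ Y : Fin (2 * m') → Γ, kernel 𝕜 V (2 * m') Y = 0)
    {α : ℝ} (hα : 0 < α) (hrow : ∀ X, ∑ Y, ‖C X Y‖ ≤ α) (hcol : ∀ Y, ∑ X, ‖C X Y‖ ≤ α) {ρ : ℝ} (hρ : 0 < ρ)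
    (hθ : Real.exp 1 * α * normV Γ κ ρ N / κ ^ 2 < 1) {p : ℕ} (hp : 2 ≤ p) (i : Fin (2 * p)) (w : Γ) :
    IsUnit (effPartitionFn 𝕜 C V) ∧
      ∑ W ∈ univ.filter (fun W : Fin (2 * p) → Γ => W i = w), ‖kernel 𝕜 (effAction 𝕜 C V) (2 * p) W‖ ≤
        ρ⁻¹ ^ (2 * p) * (Real.exp 1 * normV Γ κ ρ N) *
          (Real.exp 1 * α * normV Γ κ ρ N / κ ^ 2) ^ (p - 2) / (1 - Real.exp 1 * α * normV Γ κ ρ N / κ ^ 2) := by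
  have h := sum_norm_kernel_effAction_le_pow_of_gramBounded_of_degree C hκ hGB V hV hV0 N hN0 hN (d := 2) hdeg hα hrow
    hcol hρ hθ (n₀ := p - 1) (by omega) (r := 2 * p) (by omega) i w
  rwa [show p - 1 - 1 = p - 2 by omega] at h

/-- **`kernelNorm 1` from pinned bounds in any positive degree**: if every pinned sum of `‖K‖` is `≤ B` (`B ≥ 0`), then
`kernelNorm 1 m K ≤ B` (`m ≥ 1`). [folklore] -/
private theorem kernelNorm_one_le_of_forall_pinned {m : ℕ} (hm : 0 < m) (K : (Fin m → Γ) → 𝕜) {B : ℝ} (hB : 0 ≤ B)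
    (h : ∀ (i : Fin m) (w : Γ), ∑ W ∈ univ.filter (fun W : Fin m → Γ => W i = w), ‖K W‖ ≤ B) :
    kernelNorm 1 m K ≤ B := by
  obtain ⟨q, rfl⟩ : ∃ q, m = q + 1 := ⟨m - 1, by omega⟩
  exact kernelNorm_succ_le_of_forall 1 q K hB fun p x => by
    rw [one_pow, one_mul]
    exact h p x

/-- The quartic graded step in `kernelNorm 1` form: `kernelNorm 1 (2p) (kernel (effAction C V) (2p)) ≤ ρ^{-2p} e‖V‖_h θ^{p-2}/(1 - θ)`
for `p ≥ 2`. [cite: BenfattoGiulianiMastropietro2006, (2.13)-(2.14) and (2.77)-(2.80)] -/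
theorem kernelNorm_kernel_effAction_le_pow_of_gramBounded_quartic {κ : ℝ} (hκ : 0 < κ) (hGB : IsGramBoundedR C κ)
    (V : GrassmannAlgebra 𝕜 Γ) (hV : V ∈ evenPart 𝕜 Γ) (hV0 : constPart 𝕜 V = 0) (N : ℕ → ℝ) (hN0 : ∀ m', 0 ≤ N m')
    (hN : ∀ m' (j : Fin (2 * m')) (w : Γ), ∑ Y ∈ univ.filter (fun Y : Fin (2 * m') → Γ => Y j = w), ‖kernel 𝕜 V (2 * m') Y‖ ≤ N m')
    (hdeg : ∀ m', 2 < m' → ∀ Y : Fin (2 * m') → Γ, kernel 𝕜 V (2 * m') Y = 0)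
    {α : ℝ} (hα : 0 < α) (hrow : ∀ X, ∑ Y, ‖C X Y‖ ≤ α) (hcol : ∀ Y, ∑ X, ‖C X Y‖ ≤ α) {ρ : ℝ} (hρ : 0 < ρ)
    (hθ : Real.exp 1 * α * normV Γ κ ρ N / κ ^ 2 < 1) {p : ℕ} (hp : 2 ≤ p) :
    kernelNorm 1 (2 * p) (kernel 𝕜 (effAction 𝕜 C V) (2 * p)) ≤
      ρ⁻¹ ^ (2 * p) * (Real.exp 1 * normV Γ κ ρ N) *
        (Real.exp 1 * α * normV Γ κ ρ N / κ ^ 2) ^ (p - 2) / (1 - Real.exp 1 * α * normV Γ κ ρ N / κ ^ 2) := by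
  have hnV0 : 0 ≤ normV Γ κ ρ N := normV_nonneg hκ.le hρ.le hN0
  refine kernelNorm_one_le_of_forall_pinned (by omega) _ (div_nonneg (by positivity) (sub_nonneg.2 hθ.le)) fun i w => ?_
  exact (sum_norm_kernel_effAction_le_pow_of_gramBounded_quartic C hκ hGB V hV hV0 N hN0 hN hdeg hα hrow hcol hρ hθ hp i w).2

variable {Γ' Γ'' : Type u} [Fintype Γ'] [DecidableEq Γ'] [Fintype Γ''] [DecidableEq Γ'']

/-- **Substituting the legs costs one `L¹` norm per leg, weighted form in any positive degree**: for a linear substitution `f`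
with matrix `M` whose row sums of norms are `≤ cr` and column sums `≤ cc`, and an integration weight `ε ≥ 0`,
`‖kernel (map f F) m‖_ε ≤ cr · cc^{m-1} · ε^{m-1} · ‖kernel F m‖_1` (`m ≥ 1`; `GrassmannKernelYoung.kernelNorm_kernel_map_le` with the
weight scaled out by `kernelNorm_eq_pow_mul_kernelNorm_one`). [cite: BenfattoGiulianiMastropietro2006, (2.71a)] -/
theorem kernelNorm_kernel_map_le_of_pos (f : (Γ → 𝕜) →ₗ[𝕜] (Γ'' → 𝕜)) {cr cc : ℝ} (hcr0 : 0 ≤ cr) (hcc0 : 0 ≤ cc)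
    (hrow : ∀ y', ∑ x, ‖LinearMap.toMatrix' f y' x‖ ≤ cr) (hcol : ∀ x, ∑ y', ‖LinearMap.toMatrix' f y' x‖ ≤ cc)
    {ε : ℝ} (hε : 0 ≤ ε) (F : GrassmannAlgebra 𝕜 Γ) {m : ℕ} (hm : 0 < m) :
    kernelNorm ε m (kernel 𝕜 (ExteriorAlgebra.map f F) m) ≤
      cr * cc ^ (m - 1) * ε ^ (m - 1) * kernelNorm 1 m (kernel 𝕜 F m) := by
  obtain ⟨q, rfl⟩ : ∃ q, m = q + 1 := ⟨m - 1, by omega⟩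
  rw [Nat.add_sub_cancel, kernelNorm_eq_pow_mul_kernelNorm_one hε]
  calc ε ^ q * kernelNorm 1 (q + 1) (kernel 𝕜 (ExteriorAlgebra.map f F) (q + 1))
      ≤ ε ^ q * (cr * cc ^ q * kernelNorm 1 (q + 1) (kernel 𝕜 F (q + 1))) :=
        mul_le_mul_of_nonneg_left (kernelNorm_kernel_map_le f hcr0 hcc0 hrow hcol zero_le_one F q) (pow_nonneg hε _)
    _ = _ := by ring


/-- **The quartic graded step read in another representation of the fields** (graded, determinant-bounded twin of
`kernelNorm_kernel_map_effAction_le`; BGM 2006, (2.77) with (2.71a), (2.80)–(2.82)).  Let `V = map f Ṽ` with `Ṽ` an even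
quartic polynomial without constant part of auxiliary fields (labels `Γ'`, substitution matrix `M = toMatrix' f`; kernels of
`Ṽ` vanishing in degrees `2m' > 4`, pinned norms `≤ N(m')`), let the pulled-back covariance `C' = Mᵀ C M` be replica-Gram-bounded
with constant `κ` and have row and column sums `≤ α`, let `θ = eα‖Ṽ‖_h/κ² < 1` (`‖Ṽ‖_h = normV Γ' κ ρ N`), and let the analysis
map `g` (matrix `E`) satisfy `Σ_{X'} ‖(E M)(X'', X')‖ ≤ cr`, `Σ_{X''} ‖(E M)(X'', X')‖ ≤ cc`.  THEN `∫dμ_C e^{-V}` is a unit and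
in every degree `2p`, `p ≥ 2`, with integration weight `ε ≥ 0`,
`‖kernel (map g (effAction C V)) (2p)‖_ε ≤ cr · cc^{2p-1} · ε^{2p-1} · ρ^{-2p} · e‖Ṽ‖_h · θ^{p-2}/(1 - θ)`.
[cite: BenfattoGiulianiMastropietro2006, (2.77) with (2.71a) and (2.80)-(2.82)] -/
theorem kernelNorm_kernel_map_effAction_le_pow_of_gramBounded_quartic
    (C : Matrix Γ Γ 𝕜) (f : (Γ' → 𝕜) →ₗ[𝕜] (Γ → 𝕜)) (g : (Γ → 𝕜) →ₗ[𝕜] (Γ'' → 𝕜))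
    (Vt : GrassmannAlgebra 𝕜 Γ') (hVt : Vt ∈ evenPart 𝕜 Γ') (hVt0 : constPart 𝕜 Vt = 0) (N : ℕ → ℝ) (hN0 : ∀ m', 0 ≤ N m')
    (hN : ∀ m' (j : Fin (2 * m')) (w : Γ'), ∑ Y ∈ univ.filter (fun Y : Fin (2 * m') → Γ' => Y j = w), ‖kernel 𝕜 Vt (2 * m') Y‖ ≤ N m')
    (hdeg : ∀ m', 2 < m' → ∀ Y : Fin (2 * m') → Γ', kernel 𝕜 Vt (2 * m') Y = 0)
    {κ : ℝ} (hκ : 0 < κ) (hGB : IsGramBoundedR ((LinearMap.toMatrix' f).transpose * C * LinearMap.toMatrix' f) κ)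
    {α : ℝ} (hα : 0 < α)
    (hrow : ∀ X, ∑ Y, ‖((LinearMap.toMatrix' f).transpose * C * LinearMap.toMatrix' f) X Y‖ ≤ α)
    (hcol : ∀ Y, ∑ X, ‖((LinearMap.toMatrix' f).transpose * C * LinearMap.toMatrix' f) X Y‖ ≤ α)
    {ρ : ℝ} (hρ : 0 < ρ) (hθ : Real.exp 1 * α * normV Γ' κ ρ N / κ ^ 2 < 1)
    {cr cc : ℝ} (hcr0 : 0 ≤ cr) (hcc0 : 0 ≤ cc)
    (hrow' : ∀ X'', ∑ X', ‖(LinearMap.toMatrix' g * LinearMap.toMatrix' f) X'' X'‖ ≤ cr)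
    (hcol' : ∀ X', ∑ X'', ‖(LinearMap.toMatrix' g * LinearMap.toMatrix' f) X'' X'‖ ≤ cc)
    {ε : ℝ} (hε : 0 ≤ ε) {p : ℕ} (hp : 2 ≤ p) :
    IsUnit (effPartitionFn 𝕜 C (ExteriorAlgebra.map f Vt)) ∧
      kernelNorm ε (2 * p) (kernel 𝕜 (ExteriorAlgebra.map g (effAction 𝕜 C (ExteriorAlgebra.map f Vt))) (2 * p)) ≤
        cr * cc ^ (2 * p - 1) * ε ^ (2 * p - 1) * (ρ⁻¹ ^ (2 * p) * (Real.exp 1 * normV Γ' κ ρ N) *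
          (Real.exp 1 * α * normV Γ' κ ρ N / κ ^ 2) ^ (p - 2) / (1 - Real.exp 1 * α * normV Γ' κ ρ N / κ ^ 2)) := by
  set C' : Matrix Γ' Γ' 𝕜 := (LinearMap.toMatrix' f).transpose * C * LinearMap.toMatrix' f with hC'
  -- the normalised partition function is a unit (auxiliary representation, then `effPartitionFn_map`)
  have hunit := (sum_norm_kernel_effAction_add_sum_cumulant_le_of_gramBounded C' hκ hGB Vt hVt hVt0 N hN0 hN hα hrow hcol
    hρ hθ one_pos).1
  refine ⟨by rwa [effPartitionFn_map], ?_⟩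
  -- the graded step in the auxiliary representation
  have hbd := kernelNorm_kernel_effAction_le_pow_of_gramBounded_quartic C' hκ hGB Vt hVt hVt0 N hN0 hN hdeg hα hrow hcol hρ hθ hp
  -- the output read through `g`: kernels of `map (g ∘ f) (effAction C' Ṽ)`, Young once per leg
  rw [effAction_map, map_map_eq_map_comp]
  have hY := kernelNorm_kernel_map_le_of_pos (g ∘ₗ f) hcr0 hcc0
    (by intro X''; rw [LinearMap.toMatrix'_comp]; exact hrow' X'')
    (by intro X'; simp only [LinearMap.toMatrix'_comp]; exact hcol' X') hε (effAction 𝕜 C' Vt) (m := 2 * p) (by omega)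
  refine hY.trans (mul_le_mul_of_nonneg_left hbd (by positivity))

end Literature.MathematicalPhysics.QuantumLattice

end
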